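import Literature.AnabelianGeometry.EtaleTheta.Discharge.Sec1DtpYEllZHat
import Literature.AnabelianGeometry.AbsoluteAnabelian.ZHatCompletionFreeProcyclic
import Literature.AnabelianGeometry.EtaleTheta.DoubleUnderline
import Literature.AnabelianGeometry.AbsoluteAnabelian.FreeProcyclicOpenSubgroup
import HarnessLib

/-!
# [EtTh] §1 p. 13 / §2 p. 41: "`(Δ^tp_Y)^ell ≅ Ẑ(1)`" for finite-index subcoverings — `(Δ^tp_{Y̲̲})^ell ≅ Ẑ`
# at the [EtTh] model `Π_Y(M) = Π^tp_Y ∩ Π^tp_X̲̲` (proof-only; NV-L6 `CoreTower` input (ii), model form)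

Mochizuki, *The étale theta function and its Frobenioid-theoretic manifestations*, Publ. RIMS **45**
(2009) [EtTh], §1 p. 13 ("`(Δ^tp_Y)^ell ≅ Ẑ(1)`") and §2 p. 41 ("new coverings `Ÿ̲̲ → Ÿ`; `Y̲̲ → Y` of degree
`l`") [cite: MochizukiEtTh2009, Def 2.7 p.41]; [IUTchII] §1 Rmk. 1.1.1 (i) "`Π_M ↠ Π_Y(M) ↠ Π^ell_Y(M)`
(`≅ Ẑ(1) ⋊ G_k`)" [claim: Mochizuki2012, status: disputed] (IUTchII §1 Rmk 1.1.1 (i), kurims p.21). Layer L2 of the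
abc-iut cell, seat abc-iut-w5-d024 (gen 3), L2-lead RULINGS #3 R30 ("+ the CoreTower corollary"); PROOF-ONLY
sequel of abc-iut-w5-d006's `Discharge/Sec1DtpYEllZHat.lean` (`IsEtThOrigin.nonempty_dtpYEll_mulEquiv_zHat`,
p425316 — the [EtTh]-level theorem of record; L2-lead ruling 05:35:12Z) and of this seat's generic
`Sec1ZHatEndomorphismLevels` / `Sec1FreeTwoKernelZHat`: no definition, no instance, nothing restated.

WHY. The [IUTchII] §1 reconstruction at the [EtTh] model (`Literature.IUT.HodgeArakelov.ModelFrame.reconstruction`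
over abc-iut-L2-t8's `DoubleUnderline.rigidData` / `thetaEnvData`) has `Π_Y(M) := D.GtpY.subgroupOf C.Huu`, i.e.
`Π^tp_{Y̲̲} = Π^tp_Y ∩ Π^tp_X̲̲`, so its "`Δ^ell_Y(M) ≅ Ẑ`" (`CoreTower.deltaEll_iso` of
`Literature.IUT.HodgeArakelov.MonoThetaSymmetries`) is the statement for the FINITE-INDEX subcovering
`Y̲̲ → Y` (degree `l`, `DoubleUnderline.relIndex_Huu_GtpY`), not for `Y` itself. This file transports
`(Δ^tp_Y)^ell ≅ Ẑ` (abc-iut-w5-d006's `IsEtThOrigin.nonempty_dtpYEll_mulEquiv_zHat`, p425316) to finite-index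
subcoverings:
* `ZHatLevels.nonempty_mulEquiv_of_finiteIndex` — a finite-index subgroup of `Ẑ` is `≃* Ẑ` ("`nẐ ≅ Ẑ`": it
  contains the `n`-th powers, hence the open subgroup of index `n` — abc-iut-L4-t6's
  `eq_closureZpowersPow_of_isOpen_of_index` — so it is open, hence free procyclic by abc-iut-L4-t16's
  `IsFreeProcyclic.of_isOpen`, hence `≃ₜ* Ẑ`); `ZHatLevels.nonempty_mulEquiv_of_relIndex_ne_zero` — transport;
* `ThetaSetting.IsEtThOrigin.nonempty_inf_dtpYEll_mulEquiv_zHat` / `…_inf_dtpY_quotient_mulEquiv_zHat` — for any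
  `W ≤ Π^tp_X` with `[Δ^tp_Y : W ∩ Δ^tp_Y] ≠ 0`, the image of `W ∩ Δ^tp_Y` in `(Π^tp_X)^ell`, resp. the quotient
  `(W ∩ Δ^tp_Y)/Ker`, is `≃* Ẑ`;
* `ThetaSetting.EtaleThetaData.DoubleUnderline.nonempty_deltaYuuEll_mulEquiv_zHat` (+ image form) — the case
  `W = Π^tp_X̲̲ = C.Huu` (`relIndex_Huu_dtpY_ne_zero` from "degree `l`"): EXACTLY the shape of the `CoreTower`
  fields `kerEll := Ker(Π^tp_X ↠ (Π^tp_X)^ell) ∩ Π_Y(M)`, `deltaEll_iso`, at the [EtTh] model — modulo the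
  transport of carriers from `↥(C.Huu ⊓ D.DtpY)` to `Reconstruction.DeltaY` (an L6 bridge matter).
HONEST FRAMING: [EtTh] refereed; the theta setting / `DoubleUnderline` are data quoting print, not asserted to
exist; hypotheses `IsEtThOrigin` + `hYcl` (genuine-model clause, GAP-LEDGER G-w4d021-2) as in the parent file;
Tate twist NOT claimed; outside the [IUTchIII] Cor. 3.12 cone, no side taken; typed ≠ proved elsewhere.
-/

noncomputable section

namespace Literature.AnabelianGeometry.EtaleTheta

open Literature.AnabelianGeometry.AbsoluteAnabelian
open _root_.Topology
open CategoryTheory ProfiniteGrp ProfiniteGrp.ProfiniteCompletion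

/-! ### Finite-index subcoverings: `(Δ^tp_{Y'})^ell ≅ Ẑ`, in particular for `Y̲̲ → Y` of degree `l` -/

namespace ZHatLevels

/-- **A finite-index subgroup of `Ẑ` is isomorphic to `Ẑ`** ("`nẐ ≅ Ẑ`"): it contains the `n`-th powers
(`n` = its index), hence the open subgroup of index `n`, so it is open, hence free procyclic
(abc-iut-L4-t16's `IsFreeProcyclic.of_isOpen`) and `≃ₜ* Ẑ` (abc-iut-w5-d249/L4-t6's
`isFreeProcyclic_iff_nonempty_continuousMulEquiv_zHatCompletion`). [cite: RibesZalesskii2010, Thm 2.7.1] -/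
theorem nonempty_mulEquiv_of_finiteIndex
    (H : Subgroup (completion (GrpCat.of (Multiplicative ℤ)))) [H.FiniteIndex] :
    Nonempty (H ≃* completion (GrpCat.of (Multiplicative ℤ))) := by
  set n : ℕ := H.index with hndef
  have hn : 0 < n := Nat.pos_of_ne_zero Subgroup.FiniteIndex.index_ne_zero
  obtain ⟨g, hg⟩ := isFreeProcyclic_zHatCompletion.exists_dense_zpowers
  haveI : H.Normal := ⟨fun h hh x => by
    rwa [mul_comm_of_dense_zpowers hg x h, mul_inv_cancel_right]⟩
  obtain ⟨U, hUopen, hUidx⟩ := ZHatCompletion.exists_isOpen_index hn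
  have hU := eq_closureZpowersPow_of_isOpen_of_index hg hUopen hn hUidx
  -- the `n`-th powers form a closed set inside `H` containing `⟨η(1)ⁿ⟩`
  have hpow_closed : IsClosed (Set.range fun x : completion (GrpCat.of (Multiplicative ℤ)) => x ^ n) :=
    (isCompact_range (continuous_pow n)).isClosed
  have hpow_le : Set.range (fun x : completion (GrpCat.of (Multiplicative ℤ)) => x ^ n) ⊆ (H : Set _) := by
    rintro _ ⟨x, rfl⟩
    exact H.pow_index_mem x
  have hUH : U ≤ H := by
    rw [hU]
    intro x hx
    have hx' : x ∈ closure ((Subgroup.zpowers (g ^ n) : Subgroup _) : Set _) := by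
      rw [← Subgroup.topologicalClosure_coe]; exact hx
    refine hpow_le (closure_minimal ?_ hpow_closed hx')
    rintro _ ⟨k, rfl⟩
    refine ⟨g ^ k, ?_⟩
    dsimp only
    rw [← zpow_natCast, ← zpow_mul, ← zpow_natCast, ← zpow_mul, mul_comm]
  have hHopen : IsOpen (H : Set (completion (GrpCat.of (Multiplicative ℤ)))) :=
    Subgroup.isOpen_mono hUH hUopen
  have hHclosed : IsClosed (H : Set (completion (GrpCat.of (Multiplicative ℤ)))) := H.isClosed_of_isOpen hHopen
  haveI : CompactSpace H := isCompact_iff_compactSpace.mp hHclosed.isCompact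
  obtain ⟨e⟩ := (FundamentalExtension.isFreeProcyclic_iff_nonempty_continuousMulEquiv_zHatCompletion
    (G := H)).mp (isFreeProcyclic_zHatCompletion.of_isOpen hHopen)
  exact ⟨e.toMulEquiv⟩

/-- **Finite-index transport**: if `L ≃* Ẑ` and `K ≤ L` has finite (nonzero) relative index, then
`K ≃* Ẑ`. [cite: RibesZalesskii2010, Thm 2.7.1] -/
theorem nonempty_mulEquiv_of_relIndex_ne_zero {G : Type*} [Group G] {K L : Subgroup G} (hKL : K ≤ L)
    (hidx : K.relIndex L ≠ 0) (e : L ≃* completion (GrpCat.of (Multiplicative ℤ))) :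
    Nonempty (K ≃* completion (GrpCat.of (Multiplicative ℤ))) := by
  let H : Subgroup (completion (GrpCat.of (Multiplicative ℤ))) :=
    (K.subgroupOf L).map (e : L →* completion (GrpCat.of (Multiplicative ℤ)))
  haveI : H.FiniteIndex := ⟨by
    change ((K.subgroupOf L).map (e : L →* completion (GrpCat.of (Multiplicative ℤ)))).index ≠ 0
    rw [Subgroup.index_map_equiv]
    exact hidx⟩
  obtain ⟨f⟩ := nonempty_mulEquiv_of_finiteIndex H
  exact ⟨(Subgroup.subgroupOfEquivOfLe hKL).symm.trans
    ((Subgroup.equivMapOfInjective (K.subgroupOf L) (e : L →* completion (GrpCat.of (Multiplicative ℤ)))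
      (EquivLike.injective e)).trans f)⟩

end ZHatLevels

namespace ThetaSetting

open Literature.AnabelianGeometry.SemiGraphs ZHatLevels

variable {p : ℕ} [Fact p.Prime] {D : ThetaSetting p}

/-- **`(Δ^tp_{Y'})^ell ≅ Ẑ` for finite-index subcoverings**: under `IsEtThOrigin` + `hYcl`, for every
subgroup `W ≤ Π^tp_X` meeting `Δ^tp_Y` with finite index, the image of `W ∩ Δ^tp_Y` in `(Π^tp_X)^ell` is
again `≃* Ẑ` (a finite-index subgroup of `(Δ^tp_Y)^ell ≅ Ẑ`; [EtTh] p. 41 applies this to the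
degree-`l` covering `Y̲̲ → Y`). [cite: MochizukiEtTh2009, §1 p.13] -/
theorem IsEtThOrigin.nonempty_inf_dtpYEll_mulEquiv_zHat (hO : D.IsEtThOrigin)
    (hYcl : (D.DtpY.map D.toHat.toMonoidHom).topologicalClosure ≤
      D.DtpY.map D.toHat.toMonoidHom ⊔ (⁅⁅D.DeltaHat, D.DeltaHat⁆, D.DeltaHat⁆).topologicalClosure)
    (W : Subgroup D.PiTemp) (hW : W.relIndex D.DtpY ≠ 0) :
    Nonempty (↥((W ⊓ D.DtpY).map (D.thetaToEll.comp D.toTheta)) ≃* ZHat) := by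
  obtain ⟨e⟩ := hO.nonempty_dtpYEll_mulEquiv_zHat D hYcl
  refine nonempty_mulEquiv_of_relIndex_ne_zero (Subgroup.map_mono inf_le_right) ?_ e
  -- the image has finite index in `(Δ^tp_Y)^ell`
  rw [← Subgroup.relIndex_comap, Subgroup.comap_map_eq]
  have h1 : (W ⊓ D.DtpY).relIndex D.DtpY ≠ 0 := by rwa [Subgroup.inf_relIndex_right]
  exact fun h0 => h1 (Nat.eq_zero_of_zero_dvd (h0 ▸ Subgroup.relIndex_dvd_of_le_left D.DtpY le_sup_left))

/-- Quotient form of the same ("`Δ_Y/(Δ_Y ∩ Ker(Π_Y ↠ Π^ell_Y)) ≅ Ẑ`", the shape of the `CoreTower`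
fields `kerEll := Ker(Π^tp_X ↠ (Π^tp_X)^ell) ∩ Π_Y`, `deltaEll_iso`): for `W` as above,
`(W ∩ Δ^tp_Y) ⧸ Ker ≃* Ẑ`. [cite: MochizukiEtTh2009, §1 p.13] -/
theorem IsEtThOrigin.nonempty_inf_dtpY_quotient_mulEquiv_zHat (hO : D.IsEtThOrigin)
    (hYcl : (D.DtpY.map D.toHat.toMonoidHom).topologicalClosure ≤
      D.DtpY.map D.toHat.toMonoidHom ⊔ (⁅⁅D.DeltaHat, D.DeltaHat⁆, D.DeltaHat⁆).topologicalClosure)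
    (W : Subgroup D.PiTemp) (hW : W.relIndex D.DtpY ≠ 0) :
    Nonempty (↥(W ⊓ D.DtpY) ⧸ ((D.thetaToEll.comp D.toTheta).ker.subgroupOf (W ⊓ D.DtpY)) ≃* ZHat) := by
  obtain ⟨e⟩ := hO.nonempty_inf_dtpYEll_mulEquiv_zHat hYcl W hW
  have hker : ((D.thetaToEll.comp D.toTheta).restrict (W ⊓ D.DtpY)).ker =
      (D.thetaToEll.comp D.toTheta).ker.subgroupOf (W ⊓ D.DtpY) := by
    ext y
    rw [MonoidHom.mem_ker, MonoidHom.restrict_apply, Subgroup.mem_subgroupOf, MonoidHom.mem_ker]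
  exact ⟨(QuotientGroup.quotientMulEquivOfEq hker).symm.trans
    ((QuotientGroup.quotientKerEquivRange _).trans
      ((MulEquiv.subgroupCongr (MonoidHom.restrict_range (W ⊓ D.DtpY) (D.thetaToEll.comp D.toTheta))).trans e))⟩

end ThetaSetting

namespace ThetaSetting.EtaleThetaData.DoubleUnderline

open Literature.AnabelianGeometry.SemiGraphs ZHatLevels

variable {p : ℕ} [Fact p.Prime] {D : ThetaSetting p} {E : D.EtaleThetaData} {l : ℕ} (C : E.DoubleUnderline l)

/-- `Π^tp_X̲̲` meets `Δ^tp_Y` with finite (nonzero) index: `Δ^tp_{Y̲̲} := Π^tp_X̲̲ ∩ Δ^tp_Y` has index dividing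
`l` in `Δ^tp_Y` ("`Y̲̲ → Y` of degree `l`", p. 41). [cite: MochizukiEtTh2009, Def 2.7 p.41] -/
theorem relIndex_Huu_dtpY_ne_zero : C.Huu.relIndex D.DtpY ≠ 0 := by
  have h1 : C.Huu.relIndex D.GtpY = l := by
    rw [← Subgroup.inf_relIndex_right]; exact C.relIndex_Huu_GtpY
  intro h0
  have h2 : C.Huu.relIndex D.GtpY = 0 :=
    Subgroup.relIndex_eq_zero_of_le_right (inf_le_left : D.DtpY ≤ D.GtpY) h0
  exact C.l_ne_zero (h1.symm.trans h2)

/-- **`(Δ^tp_{Y̲̲})^ell ≅ Ẑ` at the [EtTh] model** — input (ii) of the NV-L6 `CoreTower` witness for the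
model reconstruction `Π_Y(M) = Π^tp_{Y̲̲} = Π^tp_Y ∩ Π^tp_X̲̲` (`ThetaEnvOfSetting.thetaEnvData`, `PiY :=
D.GtpY.subgroupOf C.Huu`): with `kerEll := Ker(Π^tp_X ↠ (Π^tp_X)^ell) ∩ Π^tp_{Y̲̲}`, the quotient
`Δ^tp_{Y̲̲}/(Δ^tp_{Y̲̲} ∩ kerEll)` is `≃* Ẑ` (under `IsEtThOrigin` + `hYcl`). The remaining `CoreTower`
input (i) (a `Π^tp_C` carrier with open embedding and augmentation) is abc-iut-L2-t10's `CoverData` model /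
abc-iut-L2-t1's `MuTwoSetting` (L6-lead §F v1.19a (3)); this file supplies (ii) only.
[claim: Mochizuki2012, status: disputed] (IUTchII §1 Rmk 1.1.1 (i), kurims p.21) [cite: MochizukiEtTh2009, Def 2.7 p.41] -/
theorem nonempty_deltaYuuEll_mulEquiv_zHat (hO : D.IsEtThOrigin)
    (hYcl : (D.DtpY.map D.toHat.toMonoidHom).topologicalClosure ≤
      D.DtpY.map D.toHat.toMonoidHom ⊔ (⁅⁅D.DeltaHat, D.DeltaHat⁆, D.DeltaHat⁆).topologicalClosure) :
    Nonempty (↥(C.Huu ⊓ D.DtpY) ⧸ ((D.thetaToEll.comp D.toTheta).ker.subgroupOf (C.Huu ⊓ D.DtpY)) ≃* ZHat) :=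
  hO.nonempty_inf_dtpY_quotient_mulEquiv_zHat hYcl C.Huu C.relIndex_Huu_dtpY_ne_zero

/-- Image form: the image `(Δ^tp_{Y̲̲})^ell` of `Δ^tp_{Y̲̲} = Π^tp_X̲̲ ∩ Δ^tp_Y` in `(Π^tp_X)^ell` is `≃* Ẑ`
("`Y̲̲ → Y` of degree `l`", [EtTh] p. 41; under `IsEtThOrigin` + `hYcl`). [cite: MochizukiEtTh2009, Def 2.7 p.41] -/
theorem nonempty_map_deltaYuu_mulEquiv_zHat (hO : D.IsEtThOrigin)
    (hYcl : (D.DtpY.map D.toHat.toMonoidHom).topologicalClosure ≤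
      D.DtpY.map D.toHat.toMonoidHom ⊔ (⁅⁅D.DeltaHat, D.DeltaHat⁆, D.DeltaHat⁆).topologicalClosure) :
    Nonempty (↥((C.Huu ⊓ D.DtpY).map (D.thetaToEll.comp D.toTheta)) ≃* ZHat) :=
  hO.nonempty_inf_dtpYEll_mulEquiv_zHat hYcl C.Huu C.relIndex_Huu_dtpY_ne_zero

end ThetaSetting.EtaleThetaData.DoubleUnderline

end Literature.AnabelianGeometry.EtaleTheta

end
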